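import Summits.BirchSwinnertonDyer.BirchSwinnertonDyer.Theorems.EisensteinDepletionAtTwoFamily81517IsogenySelmerBoundD
import Literature.NumberTheory.EllipticCurves.BSDRankZeroDensityProofs
import Summits.BirchSwinnertonDyer.Rank2.LambdaTransportDoorAtTwo
import Summits.BirchSwinnertonDyer.BirchSwinnertonDyer.Theorems.GoldfeldAllTwistsTwoConverseTwinAdditiveDescentCorank
import HarnessLib

/-!
**PART E (§§6–8): the counting lemma `#Ш(V')[2] ≤ #Ш(V)[φ]·#Ш(V')[φ̂]`, `corank Ш[2^∞] ≤ 1` from `#Ш[2] ≤ 2`, and the PARITY UPGRADE `corank Sel_{2^∞}(curve j n) = 3` for every odd member given Monsky `2`-parity + `RootNumberFacts`.** (one kernel unit `Family81517IsogenySelmerBound` A–E, checked as a single file rc 0; split for the 400-line lint.)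

# Route EisensteinDepletionAtTwo — door `T-r3₂`: the WHOLE odd family has `rank ≤ 3`, `rank = 3 ⇒ corank Sel_{2^∞} = 3`
UNCONDITIONALLY, and `corank Sel_{2^∞} = 3` for EVERY odd member GIVEN Monsky's `2`-parity and the root number
(parametric complete `2`-isogeny descent in the kernel; planner p2 GEN 39, landed by lead star-p1 GEN 14)

For every admissible member `(j, n)` of the door family (`m = 8j + 3`, `q = m + 64 n²`, `r = m + 289 n²` prime,
`60 ∣ n`) put `E = E_{−17q, 16qr} : y² = x(x − q)(x − 16 r)·…` (the tree's `⟨0, −17q, 0, 16qr, 0⟩`, carried to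
`Family81517.curve j n` by `(u,r,s,t) = (2,0,1,0)`, `variableChange_family81517`) and `E' = E_{34q, 225mq}`.
Because `60 ∣ n` gives `q ≡ r ≡ m (mod 3600)`, every local computation at `2`, `3`, `5` is a function of
`m mod 16 ∈ {3, 11}`, `m mod 9`, `m mod 25` only, and is settled by `decide` over `ZMod 16 / 9 / 25` UNIFORMLY IN THE MEMBER
(kit census j322002/j322023: the kill table is well defined on residues). Results (all sorry-free, standard axioms):

* `selmerGroup_subset` : `S^{(φ̂)}(E'/ℚ) = S(−17q, 16qr) ⊆ {1, q, r, qr}` (negatives die over `ℝ`, the even classes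
  `2·{1,q,r,qr}` die `2`-adically: no solutions modulo `16`), so `dim₂ S^{(φ̂)} ≤ 2`;
* `selmerGroup'_subset_three` (`m ≡ 2 (mod 3)`): `S^{(φ)}(E/ℚ) = S(34q, 225mq) ⊆ {1, mq, −q, −m, 5, 5mq, −5q, −5m}`;
  `selmerGroup'_subset_five` (`m ≡ ±2 (mod 5)`): `S(34q, 225mq) ⊆ {1, mq, −q, −m, −3, −3mq, 3q, 3m}` — the classes with
  `3 ∥ d` die modulo `9` when `m ≡ 2 (3)`, those with `5 ∥ d` die modulo `25` when `m ≡ ±2 (5)`, and the classes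
  `d ≡ 3 (mod 4)` die modulo `16`; so `dim₂ S^{(φ)} ≤ 3` whenever `m ≡ 2 (3)` or `m ≡ ±2 (5)`;
* the root-number-odd half `OddSign` is exactly «`q ≡ 2 (3)` and `q ≡ ±1 (5)`» or «`q ≡ 1 (3)` and `q ≡ ±2 (5)`», and
  `q ≡ m (mod 15)`, so on the odd half `dim₂ S + dim₂ S' ≤ 5` and **`rank E(ℚ) ≤ 3`**
  (`twoIsogeny_mordellWeilRank_add_two_le_holds`; with the tree's `two_le_mordellWeilRank_family81517`: `rank ∈ {2, 3}`);
* if `rank E(ℚ) = 3` the descent is sharp: `Ш(E/ℚ)[2] = 0`, `corank_{ℤ₂} Ш[2^∞] = 0`, **`corank Sel_{2^∞}(E) = 3`**, and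
  `(dim₂ S, dim₂ S') = (2, 3)` exactly (`forall_mem_sha_two_smul_eq_zero_of_selmerRank_add_le`,
  `selmerCorank_eq_mordellWeilRank_add_holds`), transported to `Family81517.curve j n` (`selmerCorank_eq_of_variableChange`).

* **parity upgrade (§§6–8)**: the counting form `#Ш(V')[2] ≤ #(Ш(V) ∩ im Ξ_V) · #(Ш(V') ∩ im Ξ_{V'})` of the tree's
  `TwoIsogenyShaTwoTorsion` (the tree's `GoldfeldGoodTwists.natCard_sha_inf_torsionBy_two_le`, any number field),
  hence `2^{rank+2} · #Ш(E_{a,b})[2] ≤ 2^{s+s'}` over `ℚ` (`two_pow_mul_natCard_sha_two_le`) and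
  `#Ш[2] ≤ 2 ⇒ corank_{ℤ₂} Ш[2^∞] ≤ 1` (`shaCorank_two_le_one_of_natCard_le`); so on the odd family `rank = 2` forces
  `corank Sel_{2^∞} ≤ 3`, and ODD `2^∞`-Selmer parity forces **`corank Sel_{2^∞}(curve j n) = 3` for EVERY odd member**:
  `oddFamily_selmerCorank_eq_three_of_parity (hpar : ∀ W, corank Sel_{2^∞}(W) ≡ r_an(W) (2)) (hroot : RootNumberFacts)`
  — `hpar` is VERBATIM the Monsky clause of the door's `PublishedInputsAtTwoM`, `hroot` the tree's
  `LambdaTransportDoor.RootNumberFacts` (derived in the tree from the Deligne–Rohrlich product formula + modularity).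

Door reading (`SelmerCorankEqOrderEqThreeOnOddFamily`, conjunct (ii) first half «`corank Sel_{2^∞} = 3`»): on the odd
family it is EQUIVALENT to «`rank = 3`, or `rank = 2` with `corank Ш[2^∞] = 1`», and it FOLLOWS, for every odd member, from
the published inputs already in the route's `closes` (`PublishedInputsAtTwoM` ∧ `RootNumberProductFormulaF`). The `2`-adic
order conjunct `ord_T L₂ = 3` and the infinitude are untouched: nothing here proves BSD or moves S0; Barrier B1 honest.

Sources: J. H. Silverman, *AEC* (2nd ed.), Prop. X.4.7, Thm. X.4.2(a), Prop. X.4.9, Example X.4.10, Thm. III.6.1–6.2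
[SilvermanAEC2009]; J. H. Silverman–J. Tate, *RPEC* (2015), §3.6 [SilvermanTate2015]; P. Monsky, *Generalizing the
Birch–Stephens theorem. I*, Math. Z. 221 (1996), Thm. 1.5 [Monsky1996]; T. and V. Dokchitser, Ann. of Math. 172 (2010),
Thm. 1.4 [DokchitserDokchitserAnnals2010]; R. Greenberg, LNM 1716 (1999), §1 [Greenberg1999LNM]. Kit data j322002/j322023.
-/

set_option linter.dupNamespace false
set_option linter.unusedTactic false
set_option autoImplicit false

/-! ### 6. `#Ш(V')[2] ≤ #Ш(V)[φ] · #Ш(V')[φ̂]` — ALREADY IN THE TREE: `GoldfeldGoodTwists.natCard_sha_inf_torsionBy_two_le`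
(`Theorems/GoldfeldAllTwistsTwoConverseTwinAdditiveDescentCorank.lean`, any number field); reused below (gate dedup). -/


namespace Summit.BirchSwinnertonDyer.BirchSwinnertonDyer.Theorems.Family81517IsogenySelmerBound

open scoped AddSubgroup
open Literature.Algebra.Module Literature.NumberTheory.EllipticCurves
open Summit.BirchSwinnertonDyer.Rank2
open _root_.WeierstrassCurve

variable {m q r : ℕ} {n : ℤ}

/-! ### 7. Over `ℚ`: `2^{rank+2} · #Ш(E_{a,b})[2] ≤ 2^{dim₂ S + dim₂ S'}`, `#Ш[2] ≤ 2 ⇒ corank Ш[2^∞] ≤ 1` -/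

/-- **`2^{rank E(ℚ) + 2} · #Ш(E/ℚ)[2] ≤ 2^{dim₂ S(a,b) + dim₂ S'(a,b)}`** for `E = E_{a,b}`, `b(a² − 4b) ≠ 0`: the tree's
count `2^{s+s'} = 2^{rank+2} · #(Ш(V₀) ∩ im Ξ) · #(Ш(E) ∩ im Ξ)` (`two_pow_twoIsogenySelmerRank_add_eq`, `V₀` the
half-model of `E'` with `V₀' = E` literally) and `#Ш(E)[2] ≤ #(Ш(V₀) ∩ im Ξ) · #(Ш(E) ∩ im Ξ)`
(the tree's `GoldfeldGoodTwists.natCard_sha_inf_torsionBy_two_le` at `V₀`). [cite: SilvermanAEC2009, Prop. X.4.7, Thm. X.4.2(a)] -/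
theorem two_pow_mul_natCard_sha_two_le {a b : ℤ} (hab : b * (a ^ 2 - 4 * b) ≠ 0)
    [hV₀ : (⟨0, -(a : ℚ) / 2, 0, ((a : ℚ) ^ 2 - 4 * b) / 16, 0⟩ : WeierstrassCurve ℚ).IsElliptic]
    [hE : (⟨0, (a : ℚ), 0, (b : ℚ), 0⟩ : WeierstrassCurve ℚ).IsElliptic] :
    2 ^ ((⟨0, (a : ℚ), 0, (b : ℚ), 0⟩ : WeierstrassCurve ℚ).mordellWeilRank + 2) *
        Nat.card ↥((⟨0, (a : ℚ), 0, (b : ℚ), 0⟩ : WeierstrassCurve ℚ).sha ⊓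
          AddSubgroup.torsionBy (⟨0, (a : ℚ), 0, (b : ℚ), 0⟩ : WeierstrassCurve ℚ).galH1 2) ≤
      2 ^ (twoIsogenySelmerRank a b + twoIsogenySelmerRank' a b) := by
  have key := two_pow_twoIsogenySelmerRank_add_eq hab
  have hE' := twoIsogenyCodomain_halfModel a b
  set X := Nat.card ↥((⟨0, -(a : ℚ) / 2, 0, ((a : ℚ) ^ 2 - 4 * b) / 16, 0⟩ : WeierstrassCurve ℚ).sha ⊓
      (⟨0, -(a : ℚ) / 2, 0, ((a : ℚ) ^ 2 - 4 * b) / 16, 0⟩ : WeierstrassCurve ℚ).twoIsogenyTorsorHom.range) with hX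
  set Y := Nat.card ↥((⟨0, (a : ℚ), 0, (b : ℚ), 0⟩ : WeierstrassCurve ℚ).sha ⊓
      (⟨0, (a : ℚ), 0, (b : ℚ), 0⟩ : WeierstrassCurve ℚ).twoIsogenyTorsorHom.range) with hY
  have hXY0 : X * Y ≠ 0 := by
    intro h0
    have h2 : (2 : ℕ) ^ (twoIsogenySelmerRank a b + twoIsogenySelmerRank' a b) = 0 := by
      rw [key, h0, mul_zero]
    exact absurd h2 (pow_ne_zero _ two_ne_zero)
  haveI hXfin : Finite ↥((⟨0, -(a : ℚ) / 2, 0, ((a : ℚ) ^ 2 - 4 * b) / 16, 0⟩ : WeierstrassCurve ℚ).sha ⊓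
      (⟨0, -(a : ℚ) / 2, 0, ((a : ℚ) ^ 2 - 4 * b) / 16, 0⟩ : WeierstrassCurve ℚ).twoIsogenyTorsorHom.range) :=
    Nat.finite_of_card_ne_zero (left_ne_zero_of_mul hXY0)
  have hYfin : Finite ↥((⟨0, (a : ℚ), 0, (b : ℚ), 0⟩ : WeierstrassCurve ℚ).sha ⊓
      (⟨0, (a : ℚ), 0, (b : ℚ), 0⟩ : WeierstrassCurve ℚ).twoIsogenyTorsorHom.range) :=
    Nat.finite_of_card_ne_zero (right_ne_zero_of_mul hXY0)
  -- transport along `V₀' = E` (the instances are propositions)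
  have transfer : ∀ {W₁ W₂ : WeierstrassCurve ℚ} (_ : W₁ = W₂) [W₁.IsTwoTorsionNF] [W₁.IsElliptic]
      [W₂.IsTwoTorsionNF] [W₂.IsElliptic],
      (Finite ↥(W₂.sha ⊓ W₂.twoIsogenyTorsorHom.range) → Finite ↥(W₁.sha ⊓ W₁.twoIsogenyTorsorHom.range)) ∧
      Nat.card ↥(W₁.sha ⊓ W₁.twoIsogenyTorsorHom.range) = Nat.card ↥(W₂.sha ⊓ W₂.twoIsogenyTorsorHom.range) ∧
      Nat.card ↥(W₁.sha ⊓ AddSubgroup.torsionBy W₁.galH1 2) =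
        Nat.card ↥(W₂.sha ⊓ AddSubgroup.torsionBy W₂.galH1 2) := by
    intro W₁ W₂ h _ _ _ _
    subst h
    exact ⟨id, rfl, rfl⟩
  obtain ⟨hfinT, hcardT, hcard2T⟩ := transfer hE'
  haveI := hfinT hYfin
  have hle := Summit.BirchSwinnertonDyer.BirchSwinnertonDyer.Theorems.GoldfeldGoodTwists.natCard_sha_inf_torsionBy_two_le
    (⟨0, -(a : ℚ) / 2, 0, ((a : ℚ) ^ 2 - 4 * b) / 16, 0⟩ : WeierstrassCurve ℚ)
  rw [hcardT, hcard2T] at hle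
  -- `hle : #Ш(E)[2] ≤ X * Y`
  rw [key]
  exact Nat.mul_le_mul_left _ hle

/-- **`#Ш(E/ℚ)[2] ≤ 2 ⇒ corank_{ℤ₂} Ш(E/ℚ)[2^∞] ≤ 1`**: `corank = dim Ш[2^∞][2] − dim Ш[2^∞]/2 ≤ dim₂ Ш[2]`
(`WeierstrassCurve.shaCorank`, `zpCorank`; `natCard_torsionBy_primaryComponent`, `pow_finrank_eq_natCard`).
[cite: Greenberg1999LNM, §1 pp. 54–57] -/
theorem shaCorank_two_le_one_of_natCard_le (W : WeierstrassCurve ℚ) [W.IsElliptic]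
    (h : Nat.card ↥(W.sha ⊓ AddSubgroup.torsionBy W.galH1 2) ≤ 2) : W.shaCorank 2 ≤ 1 := by
  haveI : Fact (Nat.Prime 2) := ⟨Nat.prime_two⟩
  set T : AddSubgroup W.sha := AddCommGroup.primaryComponent W.sha 2 with hT
  haveI hShafin : Finite ((W.sha)[(2 : ℤ)]) := W.finite_sha_torsionBy_holds (2 : ℤ) (by norm_num)
  have hcard1 : Nat.card (W.sha ⊓ AddSubgroup.torsionBy W.galH1 (2 : ℤ) : AddSubgroup W.galH1) =
      Nat.card ((W.sha)[(2 : ℤ)]) := (natCard_torsionBy_addSubgroup W.sha (2 : ℤ)).symm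
  have hcard2 : Nat.card (T[(2 : ℤ)]) = Nat.card ((W.sha)[(2 : ℤ)]) := natCard_torsionBy_primaryComponent
  letI : Module (ZMod 2) (T[(2 : ℤ)]) := AddSubgroup.torsionBy.zmodModule
  haveI hTfin : Finite (T[(2 : ℤ)]) :=
    Nat.finite_of_card_ne_zero (by rw [hcard2]; exact Nat.card_pos.ne')
  set u : ℕ := Module.finrank (ZMod 2) (T[(2 : ℤ)]) with hu
  have hpu : 2 ^ u = Nat.card (T[(2 : ℤ)]) := pow_finrank_eq_natCard _
  have hu1 : u ≤ 1 := by
    have h21 : 2 ^ u ≤ 2 ^ 1 := by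
      rw [hpu, hcard2, ← hcard1, pow_one]
      exact h
    exact (Nat.pow_le_pow_iff_right (by norm_num)).mp h21
  have hcorank : W.shaCorank 2 = u - Module.finrank (ZMod 2) (ModN T 2) := rfl
  rw [hcorank]
  omega

/-! ### 8. Parity upgrade: `corank Sel_{2^∞} = 3` on the WHOLE odd family from Monsky's `2`-parity and the root number -/

/-- **`corank_{ℤ₂} Sel_{2^∞}(E_{−17q,16qr}) = 3` on every odd member of odd `2^∞`-Selmer parity.** From §4:
`rank ∈ {2, 3}`; `rank = 3` is the sharp case (`sharp_of_mordellWeilRank_eq_three`); if `rank = 2` then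
`16 · #Ш(E)[2] ≤ 2^{s+s'} ≤ 32` (`two_pow_mul_natCard_sha_two_le`, `s ≤ 2`, `s' ≤ 3`), so `#Ш(E)[2] ≤ 2`,
`corank Ш[2^∞] ≤ 1` and `corank Sel_{2^∞} = rank + corank Ш ≤ 3` (`selmerCorank_eq_mordellWeilRank_add_holds`);
oddness of the corank then forces `= 3`. [cite: SilvermanAEC2009, Prop. X.4.7, Thm. X.4.2] [cite: Monsky1996, Thm. 1.5] -/
theorem selmerCorank_eq_three_of_odd (hm : m.Prime) (hq : q.Prime) (hr : r.Prime) (hn : 60 ∣ n)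
    (hq_eq : (q : ℤ) = m + 64 * n ^ 2) (hr_eq : (r : ℤ) = m + 289 * n ^ 2) (hm8 : m % 8 = 3) (hn0 : n ≠ 0)
    (hodd : m % 3 = 2 ∨ (m % 5 = 2 ∨ m % 5 = 3))
    (hpar : (⟨0, ((-17 * q : ℤ) : ℚ), 0, ((16 * q * r : ℤ) : ℚ), 0⟩ : WeierstrassCurve ℚ).selmerCorank 2 % 2 = 1) :
    (⟨0, ((-17 * q : ℤ) : ℚ), 0, ((16 * q * r : ℤ) : ℚ), 0⟩ : WeierstrassCurve ℚ).selmerCorank 2 = 3 ∧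
      (⟨0, ((-17 * q : ℤ) : ℚ), 0, ((16 * q * r : ℤ) : ℚ), 0⟩ : WeierstrassCurve ℚ).shaCorank 2 ≤ 1 := by
  have hab := family81517_hab hm hq hr hq_eq hr_eq
  haveI := isElliptic_halfModel hab
  haveI := isElliptic_mk_of_ne_zero (F := ℚ) hab
  haveI : Fact (Nat.Prime 2) := ⟨Nat.prime_two⟩
  have hsel := (⟨0, ((-17 * q : ℤ) : ℚ), 0, ((16 * q * r : ℤ) : ℚ), 0⟩ :
    WeierstrassCurve ℚ).selmerCorank_eq_mordellWeilRank_add_holds 2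
  rcases mordellWeilRank_eq_two_or_three hm hq hr hn hq_eq hr_eq hm8 hn0 hodd with h2 | h3
  · have hs := twoIsogenySelmerRank_le_two hm hq hr hn hq_eq hr_eq hm8
    have hs' := twoIsogenySelmerRank'_le_three hm hq hr hn hq_eq hr_eq hm8 hodd
    have hbound := two_pow_mul_natCard_sha_two_le (a := -17 * (q : ℤ)) (b := 16 * q * r) hab
    have h32 : 2 ^ (twoIsogenySelmerRank (-17 * (q : ℤ)) (16 * q * r) + twoIsogenySelmerRank' (-17 * (q : ℤ)) (16 * q * r)) ≤
        2 ^ 5 := Nat.pow_le_pow_right two_pos (by omega)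
    rw [h2] at hbound
    have hcard : Nat.card ↥((⟨0, ((-17 * q : ℤ) : ℚ), 0, ((16 * q * r : ℤ) : ℚ), 0⟩ : WeierstrassCurve ℚ).sha ⊓
        AddSubgroup.torsionBy (⟨0, ((-17 * q : ℤ) : ℚ), 0, ((16 * q * r : ℤ) : ℚ), 0⟩ : WeierstrassCurve ℚ).galH1 2) ≤ 2 := by
      have h' := hbound.trans h32
      norm_num at h'
      omega
    have hsha := shaCorank_two_le_one_of_natCard_le _ hcard
    refine ⟨?_, hsha⟩
    omega
  · have hsharp := sharp_of_mordellWeilRank_eq_three hm hq hr hn hq_eq hr_eq hm8 hodd h3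
    exact ⟨hsharp.2.2.1, by rw [hsharp.2.1]; norm_num⟩

/-- **Door `T-r3₂` (ii), algebraic conjunct, for `curve j n` under odd `2^∞`-Selmer parity.** [this file] -/
theorem curve_selmerCorank_eq_three_of_odd (j n : ℤ) (hadm : Family81517.AdmissibleF j n)
    (hodd : Family81517.OddSign j n) (hpar : (Family81517.curve j n).selmerCorank 2 % 2 = 1) :
    (Family81517.curve j n).selmerCorank 2 = 3 := by
  have hj : 1 ≤ j := hadm.1
  have hn0 : n ≠ 0 := hadm.2.2.1
  have hn : 60 ∣ n := hadm.2.2.2.1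
  obtain ⟨m, q, r, hm, hq, hr, hm_eq, hq_eq, hr_eq, hm8, hqOf, hrOf⟩ := params_of_admissible hadm
  have hodd' := mod_of_oddSign hm hm_eq hj hn hq_eq hqOf hodd
  have hA : 4 * ((-(34 * (j + 8 * n ^ 2)) - 13 : ℤ)) = -17 * q - 1 := by rw [hq_eq, hm_eq]; ring
  have hV := variableChange_family81517 (r := r) hA
  have hV' : (⟨Units.mk0 (2 : ℚ) two_ne_zero, 0, 1, 0⟩ : VariableChange ℚ) •
      (⟨0, ((-17 * q : ℤ) : ℚ), 0, ((16 * q * r : ℤ) : ℚ), 0⟩ : WeierstrassCurve ℚ) = Family81517.curve j n := by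
    rw [hV, curve_eq_model hqOf hrOf]
  rw [← selmerCorank_eq_of_variableChange 2 hV'] at hpar ⊢
  exact (selmerCorank_eq_three_of_odd hm hq hr hn hq_eq hr_eq hm8 hn0 hodd' hpar).1

/-- **HEADLINE (parity upgrade, whole odd family).** Monsky's `2`-parity theorem
`corank_{ℤ₂} Sel_{2^∞}(E/ℚ) ≡ ord_{s=1} L(E, s) (mod 2)` for all `E/ℚ` (the clause of the door's published-inputs pack
`PublishedInputsAtTwoM`, by name) and odd analytic rank on the odd family (`RootNumberFacts`, derived in the tree from
the Deligne–Rohrlich product formula and modularity) give, with the complete `2`-isogeny descent of this file,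
`corank_{ℤ₂} Sel_{2^∞}(curve j n) = 3` for EVERY odd admissible member — the Selmer conjunct of door `T-r3₂` (ii) on the
whole family. (The `2`-adic order conjunct and the infinitude are untouched: BSD is not proved, no S0 motion.)
[cite: Monsky1996, Thm. 1.5] [cite: DokchitserDokchitserAnnals2010, Thm. 1.4] -/
theorem oddFamily_selmerCorank_eq_three_of_parity
    (hpar : ∀ (W : WeierstrassCurve ℚ) [W.IsElliptic], W.selmerCorank 2 % 2 = W.analyticRank % 2)
    (hroot : LambdaTransportDoor.RootNumberFacts) :
    ∀ j n : ℤ, Family81517.AdmissibleF j n → Family81517.OddSign j n →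
      (Family81517.curve j n).selmerCorank 2 = 3 := by
  intro j n hadm hodd
  obtain ⟨m, q, r, hm, hq, hr, hm_eq, hq_eq, hr_eq, hm8, hqOf, hrOf⟩ := params_of_admissible hadm
  have hA : 4 * ((-(34 * (j + 8 * n ^ 2)) - 13 : ℤ)) = -17 * q - 1 := by rw [hq_eq, hm_eq]; ring
  have hV := variableChange_family81517 (r := r) hA
  haveI hEll := isElliptic_family81517 hm hq hr hq_eq hr_eq
  haveI : (Family81517.curve j n).IsElliptic := by
    rw [curve_eq_model hqOf hrOf, ← hV]; infer_instance
  have h1 := hpar (Family81517.curve j n)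
  have h2 := (hroot j n hadm hodd).1
  exact curve_selmerCorank_eq_three_of_odd j n hadm hodd (by omega)

end Summit.BirchSwinnertonDyer.BirchSwinnertonDyer.Theorems.Family81517IsogenySelmerBound
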